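import Literature.MathematicalPhysics.QuantumFieldTheory.Balaban1983to89.B9SectBL2StepAtLettersV2
import Literature.MathematicalPhysics.QuantumFieldTheory.Balaban1983to89.B9Ineq363L2Right

/-!
# `Balaban1983to89.B9SectBL2StepAtLettersV2Right` — [B9] Sect. B, the `L²` member (3.46)₂ of Theorem 3.1 FOR G′(U′U) (`‖hG′(U′U)∇*_Uλ‖`), PINNED AT
# THE LETTERS AND KERNEL-FREE: ★ `l2rightEntries_ext_of_l2Frame₂` and ★★ `stepL2nPos_two_of_l2Frame₂ : L2Frame₂ … → (readL2_2) → (writeL2_2) →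
# StepL2nPos d c35 geo bg Gp GA Cinv Gp 2` — the third of the fifteen member-steps `B9SectBStepFrameV2.SectBFrame₂` displays, inhabited from print's
# own inputs via the RIGHT-side bricks `B9Ineq363L2Right` + `B6RandomWalkL2ChainLeft` (sequel of `B9SectBL2StepAtLettersV2`, members 0, 1)

T. Bałaban, *Propagators for lattice gauge theories in a background field*, Commun. Math. Phys. **99** (1985) 389–434
[`Balaban1985BackgroundPropagators`, "B9"]; [4] = T. Bałaban, *Propagators and renormalization transformations for lattice gauge theories. II*,
Commun. Math. Phys. **96** (1984) 223–250 [`Balaban1984PropagatorsII`].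

statement-level skeleton of published theorems with citation tags; proofs where landed; nothing here is a claim about the Yang–Mills mass gap

THE PRINTED LOCUS (verbatim).  Theorem 3.1 (3.46) p. 398: *"‖hG′(U)λ‖, ‖h∇_UG′(U)λ‖, ‖hG′(U)∇*_Uλ‖, … ≤ B₀[(Lʲη)², Lʲη, Lʲη, …]|h|e^{−δ₀d(y,y′)}‖λ‖"*;
p. 398 (remarks): *"we may always replace ∇_U by ∇*_U and vice versa … Using Lemma 2.1 in [4] we may replace the factor (Lʲη)^α by (Lʲη)^β(L^{j′}η)^γ"*;
Theorem 3.4 p. 400 + p. 403 l. 1–9: *"applying Theorem 3.1 for G′(U), the bound (3.63), the representation (3.64) and Lemma 2.1 of [4] we can prove all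
the statements (3.42)–(3.47) of Theorem 3.1 for the operator G′(U′U), of course with different constants"*.

WHAT IS IN THE FILE (0 sorry; standard axioms; two explicit-constant `def`s `thetaL2R`, `rateR`).  `thetaL2R` (the `L²` smallness constant of the LEFT
composite `G′(U)V′(A)`, an upper bound of `θ_R/α₁` for `α₁ ≦ 1`), `rateR` (`= (99/100)³(49/50)·δr`), `rateR_pos`; ★ `l2rightEntries_ext_of_l2Frame₂`
(for every input (B₀, δ₀): `a₁`, `B` BEFORE the member; at every admissible U, U′ and every concrete difference letter `∇♯_k`, `k ∈ κ ⊕ κ`: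
`G′(U′U)∇♯_k ≺₂ B·Lʲη·e^{−rateR(δr)d}`); ★★ `stepL2nPos_two_of_l2Frame₂`.  PROOF ROUTE (print's, p. 403): r06's `thm34_Gp_uniform` (R1) only for the
inverse identities (`gop_eq`); `B9Ineq363L2Right.hasL2Majorant_gp_vPrime` (left composite in ℓ² from the readings n = 0 at U (`L2Frame₂.readL2`) and
n = 2 at U (`readL2_2`)); `eq365_first_of_inverse`; `hasL2Majorant_rightEntry_gpExt` with (2.61) and the two p. 398 transfers obtained from the frame's
Lemma-2.1 fields AT THE CALL RATE by `B9Thm34GFinal.ineq261_rescale` ∕ `scaleTransfer_rescale` (exponents `(1/100)(99/100)(49/50)` etc., all `≧ 9/5000`);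
smallness `θ_Rc₁ ≦ ½` forced by `α₁ ≦ 1/(2(Θ_Rc₁ + 1))`.

THE TWO EXTRA HYPOTHESES (what an instance owes beyond `L2Frame₂`, both pure unfolding of its own `KernelFamily.l2 2` against `HasL2Majorant` of its
letters): `readL2_2` — the (3.46) block at U ⇒ `G′(U)∇♯_k ≺₂ cL·B₀·Lʲη·e^{−δd}` for every `k`; `writeL2_2` — `G′(U′U)∇♯_k ≺₂ B·Lʲη·e^{−ρd}` for every `k`
(letters at the real U) ⇒ the member n = 2 of the family at U′U with the frame's writing functions `(wL B ρ, wLδ ρ)`.  Kept as theorem hypotheses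
(not a new structure) so that a successor `SectBFrame₃` can choose its field layout; NO kernel-form law.

NOT HERE (successor items): member 4 (`∇G′(U′U)∇* = ∇G′(U)∇* + (∇G′(U)V′)·(G′(U′U)∇*)`: §4 of `B9Ineq363L2Right` composed with a left composite at the
letter `∇`), members 3, 5 (second differences; index conventions of the record see the cell's LOCATED notes), the G-twins, `SectBFrame₃`.

HONEST SCOPE.  Hypothesis structure + bookkeeping; Theorem 3.1 at U is the INPUT; nothing of [B9] asserted for Bałaban's propagators; `L2Frame₂` NOT shown
inhabited; count-neutral; NOT a node discharge; nothing continuum ∕ OS ∕ mass-gap ∕ Clay.  Cell `pub-ymgap` (HUMAN RULING D-0062), Track A node N06 [B9],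
N06-ASSIGNMENT row 13, seat `pub-ymgap-dag-n06-c` (g4), 2026-08-27.
-/

noncomputable section

open scoped BigOperators

namespace Literature.MathematicalPhysics.QuantumFieldTheory.Balaban1983to89.B9SectBL2StepAtLettersV2Right

open Literature.MathematicalPhysics.QuantumFieldTheory.Balaban1983to89
open Literature.MathematicalPhysics.QuantumFieldTheory.Balaban1983to89.B6RandomWalk (HasMajorant Triangle254 Ineq261)
open Literature.MathematicalPhysics.QuantumFieldTheory.Balaban1983to89.B6RandomWalkL2 (l2n HasL2Majorant hasL2Majorant_mono)
open Literature.MathematicalPhysics.QuantumFieldTheory.Balaban1983to89.B9Thm34Ext (toB6)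
open Literature.MathematicalPhysics.QuantumFieldTheory.Balaban1983to89.B9Ineq347 (ScaleTransfer)
open Literature.MathematicalPhysics.QuantumFieldTheory.Balaban1983to89.B9Eq352DivFormLetters (conj)
open Literature.MathematicalPhysics.QuantumFieldTheory.Balaban1983to89.B9Eq352GradLetters (diffLetter)
open Literature.MathematicalPhysics.QuantumFieldTheory.Balaban1983to89.B9Eq360Vprime (gPrimeExtEnd)
open Literature.MathematicalPhysics.QuantumFieldTheory.Balaban1983to89.B9Eq360VprimeLetters (vPrimeConc)
open Literature.MathematicalPhysics.QuantumFieldTheory.Balaban1983to89.B9Thm34SectBUniformR1 (thm34_Gp_uniform)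
open Literature.MathematicalPhysics.QuantumFieldTheory.Balaban1983to89.B9Thm34GFinal (ineq261_rescale scaleTransfer_rescale)
open Literature.MathematicalPhysics.QuantumFieldTheory.Balaban1983to89.B9FromB6 (EBlock L2Block)
open Literature.MathematicalPhysics.QuantumFieldTheory.Balaban1983to89.B9SectBStepWhole (StepPos StepL2nPos)
open Literature.MathematicalPhysics.QuantumFieldTheory.Balaban1983to89.B9SectBGpStepAtLettersV2 (GpFrame₂)
open Literature.MathematicalPhysics.QuantumFieldTheory.Balaban1983to89.B9SectBL2StepAtLettersV2 (L2Frame₂ cVL2_le_one)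
open Literature.MathematicalPhysics.QuantumFieldTheory.Balaban1983to89.B9Ineq363L2 (cVL2 cVL2_nonneg hasL2Majorant_rate_mono)
open Literature.MathematicalPhysics.QuantumFieldTheory.Balaban1983to89.B9Ineq363L2Right (hasL2Majorant_gp_vPrime
  eq365_first_of_inverse hasL2Majorant_rightEntry_gpExt)

universe u

variable {I : Type} {d : ℕ} {c35 : ℝ} {geo : I → B9.Geometry} {bg : I → B9.Backgrounds}
  {Gp : ∀ i, B9.KernelFamily (geo i) (bg i)}
  {𝔸 : Type u} [NormedRing 𝔸] [NormedAlgebra ℂ 𝔸] [CompleteSpace 𝔸] {ι : Type} [Fintype ι] [DecidableEq ι]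
  {b : Module.Basis ι ℝ 𝔸} {κ : Type} [Fintype κ]
  {S : I → Type} [∀ i, Fintype (S i)] [∀ i, DecidableEq (S i)]
  [∀ i, Fintype (geo i).Site] [∀ i, DecidableEq (geo i).Site] [∀ i, Nonempty (geo i).Site]

/-- The `L²` smallness constant of the LEFT composite `G′(U)V′(A)` at the call rate δr for the frame's letters (an upper bound of `θ_R/α₁` in
`B9Ineq363L2Right.hasL2Majorant_gp_vPrime` for every `α₁ ≦ 1`, transports of norm 1): `Θ_R(B₀, δr) = (cL·B₀)Λ(δr, 1/100)c₁(δr, 1/100)·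
(cVL2(α₁ := 1) + 2|κ|·2M₂(Σ‖b‖)√#ι·e^{δr d₀})`. [cite: Balaban1985BackgroundPropagators, (3.63) p.402 («O(1)B₀α₁») + p.403 l.1–9] -/
def thetaL2R (F : L2Frame₂ c35 geo bg Gp b κ S) (B₀ δr : ℝ) : ℝ :=
  F.cL * B₀ * F.Λf δr (1 / 100) * B6.c1 (F.d261 δr) δr (1 / 100) *
    (cVL2 (Fintype.card κ) (Fintype.card ι) 1 1 F.a₀ F.Cq F.M₂ (∑ j, ‖b j‖) (Real.sqrt (∑ j, ‖b j‖ ^ 2)) (Real.exp (δr * F.d₀)) +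
      2 * Fintype.card κ * (2 * (1 : ℝ) ^ 2 * F.M₂ * (∑ j, ‖b j‖) * Real.sqrt ((1 * Fintype.card ι : ℕ) : ℝ) * Real.exp (δr * F.d₀)))

/-- The output rate of the right entries: three reductions by the factor `99/100` of the walk rate `49δr/50` (two p. 398 transfers and one
Lemma-2.1 loss). [cite: Balaban1985BackgroundPropagators, p.398 (remarks) + p.403 l.5–7 («of course with different constants»)] -/
def rateR (δr : ℝ) : ℝ := (1 - 1 / 100) * ((1 - 1 / 100) * ((1 - 1 / 100) * (49 / 50 * δr)))

omit [CompleteSpace 𝔸] [DecidableEq ι] [∀ i, DecidableEq (S i)] [∀ i, Nonempty (geo i).Site] [Fintype κ] [Fintype ι]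
  [∀ i, Fintype (S i)] [∀ i, Fintype (geo i).Site] [∀ i, DecidableEq (geo i).Site] [NormedAlgebra ℂ 𝔸] in
/-- `0 < rateR δr` for `0 < δr`. [cite: Balaban1985BackgroundPropagators, p.403 l.5–7 (bookkeeping, ours)] -/
theorem rateR_pos {δr : ℝ} (h : 0 < δr) : 0 < rateR δr := by unfold rateR; positivity

/-- ★ **THE RIGHT `L²` ENTRIES (3.46)₂ OF G′(U′U) AT THE LETTERS, KERNEL-FREE** — the core of the step below: given, on top of an `L2Frame₂`, the `L²`
READING of the member n = 2 at U for every concrete difference letter (`G′(U)∇♯_k ≺₂ cL·B₀·Lʲη·e^{−δd}`, `k ∈ κ ⊕ κ`), for every input (B₀, δ₀) > 0 there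
are `a₁ > 0`, `B ≧ 0` (before the member) such that at every (3.35)-regular U above `Mthr δr` with the (3.42) and (3.46) blocks at (B₀, δ₀) and every
U′ in (3.37) at `α₁ ≦ a₁`, every `G′(U′U)∇♯_k` carries the block-ℓ² majorant `B·Lʲη·e^{−ρ″d}`, `ρ″ = rateR δr`.  Proof: r06's `thm34_Gp_uniform` (R1)
for the inverse identities (`gop_eq`); `B9Ineq363L2Right.hasL2Majorant_gp_vPrime` (left composite in ℓ², from the readings n = 0, 2 at U);
`eq365_first_of_inverse`; ★★ `hasL2Majorant_rightEntry_gpExt` with (2.61) and the two transfers obtained from the frame's fields at the call rate by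
`ineq261_rescale` ∕ `scaleTransfer_rescale`; smallness `θ_Rc₁ ≦ ½` forced by `α₁ ≦ 1/(2(Θ_Rc₁ + 1))`.
[cite: Balaban1985BackgroundPropagators, Thm 3.4 p.400 + (3.60)–(3.65) p.402 + p.403 l.1–9 + Thm 3.1 (3.46) p.398 + p.398 (remarks); Balaban1984PropagatorsII, Lemma 2.1 p.234 + Prop. 2.6 (2.140)–(2.141) p.247] -/
theorem l2rightEntries_ext_of_l2Frame₂ (F : L2Frame₂ c35 geo bg Gp b κ S)
    (readL2_2 : ∀ i (α₀ : ℝ) (U : (bg i).Cfg) (B₀ δ : ℝ), F.MInv ≤ (geo i).M → 0 < α₀ → (geo i).M * α₀ ≤ F.aInv →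
      (bg i).Reg335 c35 α₀ U → 0 < B₀ → 0 < δ → L2Block (Gp i) B₀ δ U →
      ∀ k : κ ⊕ κ, HasL2Majorant (g := toB6 (geo i) (F.Rr i) (F.Hp i)) (fun p : S i × ι => F.blk i p.1)
        (F.Gop i U * conj b (diffLetter (F.T i) (F.coord i U) ((((geo i).eta : ℂ))⁻¹) k))
        (fun a a' => F.cL * B₀ * (geo i).len a * Real.exp (-(δ * (geo i).dist a a'))))
    {B₀ δ₀ : ℝ} (hB₀ : 0 < B₀) (hδ₀ : 0 < δ₀) :
    ∃ a₁ : ℝ, 0 < a₁ ∧ ∃ B : ℝ, 0 ≤ B ∧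
      ∀ (i : I) (α₀ : ℝ) (U : (bg i).Cfg), F.Mthr (F.rate δ₀) ≤ (geo i).M → 0 < α₀ → (geo i).M * α₀ ≤ F.aInv →
        (bg i).Reg335 c35 α₀ U → EBlock (Gp i) B₀ δ₀ U → L2Block (Gp i) B₀ δ₀ U →
        ∀ (α₁ : ℝ) (U' : (bg i).Cfg), 0 < α₁ → α₁ ≤ a₁ → (bg i).Cplx337 α₁ U U' →
          ∀ k : κ ⊕ κ, HasL2Majorant (g := toB6 (geo i) (F.Rr i) (F.Hp i)) (fun p : S i × ι => F.blk i p.1)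
            (F.Gop i ((bg i).mul U' U) * conj b (diffLetter (F.T i) (F.coord i U) ((((geo i).eta : ℂ))⁻¹) k))
            (fun a a' => B * (geo i).len a * Real.exp (-(rateR (F.rate δ₀) * (geo i).dist a a'))) := by
  set δr : ℝ := F.rate δ₀ with hδr_def
  have hδr : 0 < δr := F.rate_pos hδ₀
  have hδrc : δr ≤ F.δcap := F.rate_le_cap δ₀
  have hBG : 0 < F.cR * B₀ := mul_pos F.cR_pos hB₀
  have hBL : 0 < F.cL * B₀ := mul_pos F.cL_pos hB₀
  have hSb : 0 ≤ ∑ j, ‖b j‖ := Finset.sum_nonneg fun j _ => norm_nonneg _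
  have hSb2 : 0 ≤ Real.sqrt (∑ j, ‖b j‖ ^ 2) := Real.sqrt_nonneg _
  -- r06's uniform clause for G′ (R1) at the call rate (only for the inverse identities of the extension)
  obtain ⟨a₁, ha₁, B', -, H⟩ := thm34_Gp_uniform b κ (F.d261 δr) δr (F.cR * B₀) F.Cq F.a₀ F.d₀ F.M₂ (F.Λf δr)
    hBG F.Cq_nonneg F.a₀_nonneg F.M₂_nonneg hδr (fun α hα => F.Λf_one_le _ α hδr hα) F.hrepr
  -- the smallness constant, the walk's c₁, the two transfer constants
  set Θ : ℝ := thetaL2R F B₀ δr with hΘ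
  set c₁' : ℝ := B6.c1 (F.d261 δr) ((1 - 1 / 100) * (49 / 50 * δr)) (1 / 100) with hc₁'
  set Λ₁ : ℝ := F.Λf δr (1 / 100 * (49 / 50)) with hΛ₁
  set Λ₂ : ℝ := F.Λf δr (1 / 100 * (1 - 1 / 100) * (1 - 1 / 100) * (49 / 50)) with hΛ₂
  have hc₁'0 : 0 ≤ c₁' := B6RandomWalk.c1_nonneg _ _ _
  have hΛ1 : 1 ≤ F.Λf δr (1 / 100) := F.Λf_one_le δr _ hδr (by norm_num)
  have hΛ0 : 0 ≤ F.Λf δr (1 / 100) := zero_le_one.trans hΛ1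
  have hΛ₁0 : 0 ≤ Λ₁ := zero_le_one.trans (F.Λf_one_le δr _ hδr (by norm_num))
  have hΛ₂0 : 0 ≤ Λ₂ := zero_le_one.trans (F.Λf_one_le δr _ hδr (by norm_num))
  have hΘ0 : 0 ≤ Θ := by
    rw [hΘ, thetaL2R]
    have := cVL2_nonneg (d := Fintype.card κ) (nι := Fintype.card ι) (ρu := 1) zero_le_one F.a₀_nonneg F.Cq_nonneg F.M₂_nonneg
      hSb hSb2 (Real.exp_nonneg (δr * F.d₀))
    have := B6RandomWalk.c1_nonneg (F.d261 δr) δr (1 / 100)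
    have := F.cL_pos
    have := F.M₂_nonneg
    positivity
  have hden : 0 < 2 * (Θ * c₁' + 1) := by positivity
  set a : ℝ := min a₁ (min (1 / 4) (1 / (2 * (Θ * c₁' + 1)))) with ha_def
  have ha0 : 0 < a := lt_min ha₁ (lt_min (by norm_num) (by positivity))
  refine ⟨a, ha0, F.cL * B₀ * Λ₁ * c₁' * 2 * Λ₂, by positivity, ?_⟩
  intro i α₀ U hM0 hα₀ hMa hU hE hL2 α₁ U' hα₁ ha hU' k
  have hM : F.MInv ≤ (geo i).M := F.MInv_le_of_Mthr_le hM0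
  have ha1 : α₁ ≤ a₁ := ha.trans (min_le_left _ _)
  have haq : α₁ ≤ 1 / 4 := ha.trans ((min_le_right _ _).trans (min_le_left _ _))
  have haΘ : α₁ ≤ 1 / (2 * (Θ * c₁' + 1)) := ha.trans ((min_le_right _ _).trans (min_le_right _ _))
  have hα1 : α₁ ≤ 1 := haq.trans (by norm_num)
  -- the sup letters at U (for r06) and the inverse identities of the extension
  obtain ⟨hΔG, hGΔ⟩ := F.reg_inv i α₀ U hM hα₀ hMa hU
  obtain ⟨h1, h2, h3, -⟩ := F.read342_le i α₀ U hM hα₀ hMa hU hB₀ hδ₀ (F.rate_le δ₀) hE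
  obtain ⟨hkF, hsF, h337s, h337F, h337B, hA, hAτ⟩ := F.cplx i α₁ U U' hα₁ hU'
  obtain ⟨hinv1, hinv2, -, -⟩ := H (F.T i) (F.coord i U) (F.blk i) (F.kQ i U) (F.sQ i U) (F.cfun i) (F.w i U)
    (F.dist_nonneg i) (F.triangle i) (F.dist_self i) (F.dist_comm i) (F.len_pos i) (F.eta_le_len i) (F.eta_pos i)
    (F.h261_of i hδr hδrc hM0) (F.hST_of i hδr hδrc hM0) (F.unitary i U)
    (F.stencilB i) (F.stencilF i) (F.stencil0 i) (F.w_nonneg i U) (F.card_w i U) (F.hkQ i U) (F.hsQ i U) (F.hcfun i)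
    hΔG hGΔ h1 h2 h3 α₁ hα₁.le ha1 (F.expA i U U') (F.kF i U U') (F.sF i U U')
    hkF hsF h337s h337F h337B hA hAτ
  have hG := F.gop_eq i ((bg i).mul U' U) _ _ (F.mul_law i α₁ U U' hα₁ hU') hinv1 hinv2
  -- the L² readings of Theorem 3.1 at U (members 0 and 2), lowered to the walk rate 49δr/50 resp. the call rate δr
  obtain ⟨l0, -⟩ := F.readL2 i α₀ U B₀ δ₀ hM hα₀ hMa hU hB₀ hδ₀ hL2
  have r2 := readL2_2 i α₀ U B₀ δ₀ hM hα₀ hMa hU hB₀ hδ₀ hL2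
  have hw2 : ∀ a : (geo i).Site, 0 ≤ (geo i).len a ^ 2 := fun a => sq_nonneg _
  have hw1 : ∀ a : (geo i).Site, 0 ≤ (geo i).len a := fun a => (F.len_pos i a).le
  have hρδr : 49 / 50 * δr ≤ δr := by nlinarith
  have hρδ₀ : 49 / 50 * δr ≤ δ₀ := hρδr.trans (F.rate_le δ₀)
  have l0' := hasL2Majorant_rate_mono (R := F.Rr i) (H := F.Hp i) (fun p : S i × ι => F.blk i p.1) (F.cL * B₀)
    (fun a => (geo i).len a ^ 2) hBL.le hw2 (F.rate_le δ₀) (F.dist_nonneg i) l0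
  have r2' := fun k => hasL2Majorant_rate_mono (R := F.Rr i) (H := F.Hp i) (fun p : S i × ι => F.blk i p.1) (F.cL * B₀)
    (fun a => (geo i).len a) hBL.le hw1 (F.rate_le δ₀) (F.dist_nonneg i) (r2 k)
  have r2ρ := fun k => hasL2Majorant_rate_mono (R := F.Rr i) (H := F.Hp i) (fun p : S i × ι => F.blk i p.1) (F.cL * B₀)
    (fun a => (geo i).len a) hBL.le hw1 hρδ₀ (F.dist_nonneg i) (r2 k)
  -- Lemma 2.1 at the call rate, exponent 1/100; the inverse-weight scale transfers
  have h261β : Ineq261 (F.d261 δr) (toB6 (geo i) (F.Rr i) (F.Hp i)) δr (1 / 100) :=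
    F.h261_of i hδr hδrc hM0 (1 / 100) (by norm_num) (by norm_num)
  obtain ⟨-, -, hT1i, hT2i, -, -⟩ := F.hST_of i hδr hδrc hM0 (1 / 100) (by norm_num)
  -- the left composite G′(U)·V′(A) in L² at this member
  have hsmall4 : ∀ y : (geo i).Site, (geo i).eta * (α₁ * ((geo i).len y)⁻¹) ≤ 1 / 4 := by
    intro y
    have hl := F.len_pos i y
    have h1 : (geo i).eta * ((geo i).len y)⁻¹ ≤ 1 := by
      rw [← div_eq_mul_inv]; exact (div_le_one hl).mpr (F.eta_le_len i y)
    calc (geo i).eta * (α₁ * ((geo i).len y)⁻¹) = α₁ * ((geo i).eta * ((geo i).len y)⁻¹) := by ring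
      _ ≤ α₁ * 1 := mul_le_mul_of_nonneg_left h1 hα₁.le
      _ ≤ 1 / 4 := by rw [mul_one]; exact haq
  have hr : 49 / 50 * δr + (1 / 100 + 1 / 100) * δr ≤ δr := by nlinarith
  have hMV := hasL2Majorant_gp_vPrime (Rr := F.Rr i) (H := F.Hp i) b (F.T i) (F.coord i U) (F.blk i) (F.d261 δr) (F.eta_pos i)
    (F.expA i U U') (F.kQ i U) (F.kF i U U') (F.sQ i U) (F.sF i U U') (F.cfun i) (F.w i U) 1 F.d₀ F.M₂ F.Cq F.a₀
    δr δr (1 / 100) (1 / 100) (49 / 50 * δr) (F.Λf δr (1 / 100)) (F.cL * B₀) α₁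
    hBL.le hα₁.le hΛ0 (by positivity) (by norm_num) (by norm_num) hδr.le hδr.le hr
    (F.dist_nonneg i) (F.triangle i) (F.len_pos i) h261β hT1i hT2i F.M₂_nonneg F.hrepr hsmall4
    (fun μ x => ⟨hA μ x, hAτ μ μ x⟩) (fun μ x => h337s μ μ x) (fun μ x => h337F μ μ x) h337B (fun μ x => F.unitary i U μ x)
    (fun μ x => ⟨F.stencilF i μ x, F.stencilB i μ x⟩) (F.stencil0 i)
    (F.w_nonneg i U) (F.card_w i U) F.Cq_nonneg F.a₀_nonneg (F.hkQ i U) hkF (F.hsQ i U) hsF (F.hcfun i) l0' r2'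
  -- θ_R ≤ Θ·α₁ and the smallness θ_R·c₁ ≤ ½
  set θ : ℝ := F.cL * B₀ * F.Λf δr (1 / 100) * B6.c1 (F.d261 δr) δr (1 / 100) *
      (cVL2 (Fintype.card κ) (Fintype.card ι) 1 α₁ F.a₀ F.Cq F.M₂ (∑ j, ‖b j‖) (Real.sqrt (∑ j, ‖b j‖ ^ 2))
          (Real.exp (δr * F.d₀)) +
        2 * Fintype.card κ * (2 * (1 : ℝ) ^ 2 * F.M₂ * (∑ j, ‖b j‖) * Real.sqrt ((1 * Fintype.card ι : ℕ) : ℝ) *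
          Real.exp (δr * F.d₀))) * α₁ with hθ
  have hcV0 : 0 ≤ cVL2 (Fintype.card κ) (Fintype.card ι) 1 α₁ F.a₀ F.Cq F.M₂ (∑ j, ‖b j‖) (Real.sqrt (∑ j, ‖b j‖ ^ 2))
      (Real.exp (δr * F.d₀)) :=
    cVL2_nonneg (d := Fintype.card κ) (nι := Fintype.card ι) (ρu := 1) hα₁.le F.a₀_nonneg F.Cq_nonneg F.M₂_nonneg hSb hSb2
      (Real.exp_nonneg (δr * F.d₀))
  have hK0 : 0 ≤ 2 * (Fintype.card κ : ℝ) * (2 * (1 : ℝ) ^ 2 * F.M₂ * (∑ j, ‖b j‖) * Real.sqrt ((1 * Fintype.card ι : ℕ) : ℝ) *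
      Real.exp (δr * F.d₀)) := by have := F.M₂_nonneg; positivity
  have hpre0 : 0 ≤ F.cL * B₀ * F.Λf δr (1 / 100) * B6.c1 (F.d261 δr) δr (1 / 100) := by
    have := B6RandomWalk.c1_nonneg (F.d261 δr) δr (1 / 100); positivity
  have hθ0 : 0 ≤ θ := by
    rw [hθ]
    exact mul_nonneg (mul_nonneg hpre0 (add_nonneg hcV0 hK0)) hα₁.le
  have hθΘ : θ ≤ Θ * α₁ := by
    rw [hθ, hΘ, thetaL2R]
    have hcv := cVL2_le_one (dκ := Fintype.card κ) (nι := Fintype.card ι) (E₀ := Real.exp (δr * F.d₀)) hα1 F.a₀_nonneg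
      F.Cq_nonneg F.M₂_nonneg hSb hSb2 (Real.exp_nonneg _)
    have hsum := add_le_add hcv
      (le_refl (2 * (Fintype.card κ : ℝ) * (2 * (1 : ℝ) ^ 2 * F.M₂ * (∑ j, ‖b j‖) * Real.sqrt ((1 * Fintype.card ι : ℕ) : ℝ) *
        Real.exp (δr * F.d₀))))
    exact mul_le_mul_of_nonneg_right (mul_le_mul_of_nonneg_left hsum hpre0) hα₁.le
  have hsmall : θ * c₁' ≤ 1 / 2 := by
    have h1 : θ * c₁' ≤ Θ * c₁' * α₁ :=
      calc θ * c₁' ≤ Θ * α₁ * c₁' := mul_le_mul_of_nonneg_right hθΘ hc₁'0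
        _ = Θ * c₁' * α₁ := by ring
    have h2 : Θ * c₁' * α₁ ≤ Θ * c₁' * (1 / (2 * (Θ * c₁' + 1))) := mul_le_mul_of_nonneg_left haΘ (mul_nonneg hΘ0 hc₁'0)
    have h3 : Θ * c₁' * (1 / (2 * (Θ * c₁' + 1))) ≤ 1 / 2 := by
      rw [mul_one_div, div_le_iff₀ hden]
      have := mul_nonneg hΘ0 hc₁'0
      linarith
    linarith
  have hsmall' : θ * c₁' < 1 := by linarith
  have hMV' : HasL2Majorant (g := toB6 (geo i) (F.Rr i) (F.Hp i)) (fun p : S i × ι => F.blk i p.1)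
      (F.Gop i U * conj b (vPrimeConc (F.T i) (F.coord i U) (geo i).eta (F.expA i U U') (F.blk i) (F.kQ i U) (F.kF i U U')
        (F.sQ i U) (F.sF i U U') (F.cfun i)))
      (fun a a' => θ * Real.exp (-(49 / 50 * δr * (geo i).dist a a'))) := by
    refine hasL2Majorant_mono (g := toB6 (geo i) (F.Rr i) (F.Hp i)) _ hMV fun a a' => le_of_eq ?_
    rw [hθ]
  -- (3.65)₁ from the inverse identities; Lemma 2.1 and the two transfers at the walk's rates, by rescaling from the call rate
  have h365 := eq365_first_of_inverse hGΔ hinv1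
  have h261w : Ineq261 (F.d261 δr) (toB6 (geo i) (F.Rr i) (F.Hp i)) ((1 - 1 / 100) * (49 / 50 * δr)) (1 / 100) :=
    ineq261_rescale (ineq261_rescale (F.h261_of i hδr hδrc hM0 (1 / 100 * (1 - 1 / 100) * (49 / 50)) (by norm_num) (by norm_num)))
  obtain ⟨hT₁, -, -, -, -, -⟩ := F.hST_of i hδr hδrc hM0 (1 / 100 * (49 / 50)) (by norm_num)
  obtain ⟨hT₂, -, -, -, -, -⟩ := F.hST_of i hδr hδrc hM0 (1 / 100 * (1 - 1 / 100) * (1 - 1 / 100) * (49 / 50)) (by norm_num)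
  have hT₁' : ScaleTransfer (geo i) (49 / 50 * δr) (1 / 100) Λ₁ (fun a => (geo i).len a) := by
    rw [hΛ₁]; exact scaleTransfer_rescale hT₁
  have hT₂' : ScaleTransfer (geo i) ((1 - 1 / 100) * ((1 - 1 / 100) * (49 / 50 * δr))) (1 / 100) Λ₂ (fun a => (geo i).len a) := by
    rw [hΛ₂]; exact scaleTransfer_rescale (scaleTransfer_rescale (scaleTransfer_rescale hT₂))
  have hρ0 : 0 ≤ 49 / 50 * δr := by positivity
  have h := hasL2Majorant_rightEntry_gpExt (R := F.Rr i) (H := F.Hp i) (fun p : S i × ι => F.blk i p.1) (F.d261 δr)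
    (49 / 50 * δr) (1 / 100) (1 / 100) (1 / 100) θ (F.cL * B₀) Λ₁ Λ₂ (fun a => (geo i).len a) hBL.le hΛ₁0 hw1 hθ0 hρ0
    (by norm_num) (by norm_num) (by norm_num) (F.triangle i) (F.dist_self i) (F.dist_comm i) (F.dist_nonneg i) h261w hsmall'
    hT₁' hT₂' h365 (r2ρ k) hMV'
  rw [← hG] at h
  have hfactor : F.cL * B₀ * Λ₁ * c₁' * (1 - θ * c₁')⁻¹ * Λ₂ ≤ F.cL * B₀ * Λ₁ * c₁' * 2 * Λ₂ := by
    have hpos : 0 < 1 - θ * c₁' := by linarith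
    have : (1 - θ * c₁')⁻¹ ≤ 2 := by
      rw [inv_le_comm₀ hpos (by norm_num : (0 : ℝ) < 2)]; linarith
    have h0 : 0 ≤ F.cL * B₀ * Λ₁ * c₁' := by positivity
    exact mul_le_mul_of_nonneg_right (mul_le_mul_of_nonneg_left this h0) hΛ₂0
  refine hasL2Majorant_mono (g := toB6 (geo i) (F.Rr i) (F.Hp i)) _ h fun a a' => ?_
  have he : 0 ≤ (geo i).len a * Real.exp (-(rateR δr * (geo i).dist a a')) := mul_nonneg (hw1 a) (Real.exp_nonneg _)
  calc F.cL * B₀ * Λ₁ * B6.c1 (F.d261 δr) ((1 - 1 / 100) * (49 / 50 * δr)) (1 / 100) *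
        (1 - θ * B6.c1 (F.d261 δr) ((1 - 1 / 100) * (49 / 50 * δr)) (1 / 100))⁻¹ * Λ₂ * (geo i).len a *
        Real.exp (-((1 - 1 / 100) * ((1 - 1 / 100) * ((1 - 1 / 100) * (49 / 50 * δr))) * (geo i).dist a a'))
      = (F.cL * B₀ * Λ₁ * c₁' * (1 - θ * c₁')⁻¹ * Λ₂) * ((geo i).len a * Real.exp (-(rateR δr * (geo i).dist a a'))) := by
        rw [hc₁', rateR]; ring
    _ ≤ (F.cL * B₀ * Λ₁ * c₁' * 2 * Λ₂) * ((geo i).len a * Real.exp (-(rateR δr * (geo i).dist a a'))) :=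
        mul_le_mul_of_nonneg_right hfactor he
    _ = _ := by ring

/-- ★★ **THE (3.46)₂-STEP OF SECT. B FOR G′(U′U) (`‖hG′(U′U)∇*_Uλ‖`), INHABITED AT THE LETTERS, KERNEL-FREE**: every `L2Frame₂` together with the `L²`
READING of member 2 at U per concrete difference letter (`readL2_2`) and its WRITING at U′U (`writeL2_2`: block-ℓ² majorants of every `G′(U′U)∇♯_k` at
`(B, ρ)` ⇒ the member n = 2 of the family at U′U with the frame's writing functions `(wL B ρ, wLδ ρ)`) inhabits
`B9SectBStepWhole.StepL2nPos d c35 geo bg Gp GA Cinv Gp 2` (output at `ρ″ = rateR (rate δ₀)`) — the third of the fifteen member-steps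
`B9SectBStepFrameV2.SectBFrame₂` displays, framed from print's own inputs ((3.46) at U, (3.60)–(3.65), [4] Lemma 2.1, p. 398's convention).
[cite: Balaban1985BackgroundPropagators, Thm 3.4 p.400 + Thm 3.1 (3.46) p.398 + p.398 (remarks) + (3.60)–(3.65) p.402 + p.403 l.1–9; Balaban1984PropagatorsII, Prop. 2.6 (2.140)–(2.141) p.247 + Lemma 2.1 p.234] -/
theorem stepL2nPos_two_of_l2Frame₂ (F : L2Frame₂ c35 geo bg Gp b κ S)
    (readL2_2 : ∀ i (α₀ : ℝ) (U : (bg i).Cfg) (B₀ δ : ℝ), F.MInv ≤ (geo i).M → 0 < α₀ → (geo i).M * α₀ ≤ F.aInv →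
      (bg i).Reg335 c35 α₀ U → 0 < B₀ → 0 < δ → L2Block (Gp i) B₀ δ U →
      ∀ k : κ ⊕ κ, HasL2Majorant (g := toB6 (geo i) (F.Rr i) (F.Hp i)) (fun p : S i × ι => F.blk i p.1)
        (F.Gop i U * conj b (diffLetter (F.T i) (F.coord i U) ((((geo i).eta : ℂ))⁻¹) k))
        (fun a a' => F.cL * B₀ * (geo i).len a * Real.exp (-(δ * (geo i).dist a a'))))
    (writeL2_2 : ∀ i (U U' : (bg i).Cfg) (α₁ B δ : ℝ), 0 < α₁ → α₁ ≤ F.aW → (bg i).Cplx337 α₁ U U' → 0 ≤ B → 0 < δ →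
      (∀ k : κ ⊕ κ, HasL2Majorant (g := toB6 (geo i) (F.Rr i) (F.Hp i)) (fun p : S i × ι => F.blk i p.1)
          (F.Gop i ((bg i).mul U' U) * conj b (diffLetter (F.T i) (F.coord i U) ((((geo i).eta : ℂ))⁻¹) k))
          (fun a a' => B * (geo i).len a * Real.exp (-(δ * (geo i).dist a a')))) →
      ∀ (lam : (geo i).Loc) (h : (geo i).Cut) (y y' : (geo i).Site), (geo i).cutIn h y → (geo i).suppIn lam y' →
        (Gp i).l2 2 ((bg i).mul U' U) lam h ≤
          F.wL B δ * B9.pref6 ((geo i).len y) 2 * (geo i).cutSup h * Real.exp (-(F.wLδ δ * (geo i).dist y y')) *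
            (geo i).l2Norm lam)
    (GA : ∀ i, B9.KernelFamily (geo i) (bg i)) (Cinv : ∀ i, B9.SiteKernel (geo i) (bg i)) :
    StepL2nPos d c35 geo bg Gp GA Cinv Gp 2 := by
  intro B₀ δ₀ Bβ Bε Bεβ B₁ δ₁ hB₀ hδ₀ _ _
  obtain ⟨a₁, ha₁, B, hB, Hc⟩ := l2rightEntries_ext_of_l2Frame₂ F readL2_2 hB₀ hδ₀
  have hρ' : 0 < rateR (F.rate δ₀) := rateR_pos (F.rate_pos hδ₀)
  refine ⟨F.Mthr (F.rate δ₀), min a₁ F.aW, F.aInv, (F.wL B (rateR (F.rate δ₀)), F.wLδ (rateR (F.rate δ₀))), F.Mthr_pos _,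
    lt_min ha₁ F.aW_pos, F.aInv_pos, ⟨F.wL_pos B _ hB hρ', F.wLδ_pos _ hρ'⟩, ?_⟩
  intro i hM0 α₀ hα₀ hMa U hU hT α₁ hα₁ ha U' hU' lam h y y' hcut hs
  have e2 := Hc i α₀ U hM0 hα₀ hMa hU hT.1.1.1 hT.1.1.2.1 α₁ U' hα₁ (le_trans ha (min_le_left _ _)) hU'
  exact writeL2_2 i U U' α₁ B _ hα₁ (le_trans ha (min_le_right _ _)) hU' hB hρ' e2 lam h y y' hcut hs

end Literature.MathematicalPhysics.QuantumFieldTheory.Balaban1983to89.B9SectBL2StepAtLettersV2Right
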